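import Mathlib.MeasureTheory.Function.LpSeminorm.ChebyshevMarkov
import Mathlib.MeasureTheory.Function.LpSeminorm.Basic
import Mathlib.Analysis.SpecialFunctions.Pow.Continuity
import Mathlib.Analysis.SpecificLimits.Normed
import HarnessLib

/-!
# Moser's iteration: from a chain of reverse Hölder inequalities to an `L^∞` bound

Analysis/FunctionSpaces proofs file (theorems only). The abstract bookkeeping step of every
Moser iteration (J. Moser, *A new proof of De Giorgi's theorem*, CPAM 13 (1960); *A Harnack
inequality for parabolic differential equations*, CPAM 17 (1964); Gilbarg–Trudinger, proof of
Thm. 8.15; Lieberman, *Second Order Parabolic Differential Equations*, §VI.5), isolated as a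
measure-theoretic lemma:

* `eLpNorm_top_le_of_eLpNorm_le_of_tendsto` — **`‖f‖_∞ ≤ lim ‖f‖_{p_k}`-type bound**: if
  `p_k → ∞` and `‖f‖_{L^{p_k}(μ)} ≤ L_k` with `L_k → L`, then `‖f‖_{L^∞(μ)} ≤ L` (Chebyshev's
  inequality `t μ{‖f‖ ≥ t}^{1/p} ≤ ‖f‖_p` and `μ{‖f‖ ≥ t}^{1/p} → 1`);
* `eLpNorm_top_le_of_moser_chain` — **Moser's iteration**: on a decreasing sequence of sets
  `A₀ ⊇ A₁ ⊇ ⋯` with exponents `p_k = p₀ χ^k`, `χ > 1`, the chain of reverse Hölder inequalities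
  `‖f‖_{L^{p_{k+1}}(A_{k+1})} ≤ (C₀ b^k)^{1/p_k} ‖f‖_{L^{p_k}(A_k)}` (`k ≥ 0`) gives
  `‖f‖_{L^∞(⋂ A_k)} ≤ C₀^{χ/(p₀(χ−1))} b^{χ/(p₀(χ−1)²)} ‖f‖_{L^{p₀}(A₀)}`
  (the exponents are `∑ 1/p_k` and `∑ k/p_k`).

This is the step "(2.5) ⇒ by iteration ⇒ (2.6)" of Lei–Zhang, J. Funct. Anal. 261 (2011) =
arXiv:1011.5066, p. 8 (with `χ = 10/9`, `p_k` there written `3q`, `q = (10/9)^j`,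
`C₀ = K^{3/2} R^{-1/2}`, `b = σ^{-3}`), an ingredient of step 1 of the printed proof of their
Theorem 1.2 (the tree's named fact `LeiZhang2011_liouville`).

## References

* D. Gilbarg, N. S. Trudinger, *Elliptic PDE of Second Order* (2001), proof of Thm. 8.15.
  [GilbargTrudinger2001]
* G. M. Lieberman, *Second Order Parabolic Differential Equations* (1996), §VI.5–6.
  [Lieberman1996]
* Z. Lei, Q. S. Zhang, J. Funct. Anal. 261 (2011) = arXiv:1011.5066, §2 (2.5)–(2.6), p. 8.
  [LeiZhang2011]
-/

noncomputable section

open MeasureTheory Set Filter Topology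
open scoped ENNReal NNReal

namespace Literature.Analysis.FunctionSpaces

variable {α : Type*} [MeasurableSpace α] {μ : Measure α}
variable {E : Type*} [NormedAddCommGroup E]

/-- **`‖f‖_{L^∞} ≤ lim_k ‖f‖_{L^{p_k}}`-type bound.** If `p_k → ∞` (`p_k > 0`),
`‖f‖_{L^{p_k}(μ)} ≤ L_k` for all `k` and `L_k → L` in `[0, ∞]`, then `‖f‖_{L^∞(μ)} ≤ L`: for
`t < ess sup ‖f‖` the set `{‖f‖ ≥ t}` has positive measure `m`, Chebyshev gives
`t m^{1/p_k} ≤ ‖f‖_{p_k} ≤ L_k`, and `m^{1/p_k} → 1` (or `m = ∞`, when every `L_k = ∞`).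
[folklore] -/
theorem eLpNorm_top_le_of_eLpNorm_le_of_tendsto {f : α → E} (hf : AEStronglyMeasurable f μ)
    {p : ℕ → ℝ} (hp : ∀ k, 0 < p k) (hptop : Tendsto p atTop atTop) {L : ℕ → ℝ≥0∞}
    {Lim : ℝ≥0∞} (hL : ∀ k, eLpNorm f (ENNReal.ofReal (p k)) μ ≤ L k)
    (hLim : Tendsto L atTop (𝓝 Lim)) : eLpNorm f ∞ μ ≤ Lim := by
  rw [eLpNorm_exponent_top, eLpNormEssSup]
  refine le_of_forall_lt_imp_le_of_dense fun t ht => ?_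
  -- the level set `{t ≤ ‖f‖}` has positive measure
  set S : Set α := {x | t ≤ ‖f x‖ₑ} with hS
  have hS0 : μ S ≠ 0 := by
    intro h0
    have hae : ∀ᵐ x ∂μ, ‖f x‖ₑ ≤ t := by
      rw [ae_iff]
      refine measure_mono_null (fun x hx => ?_) h0
      simp only [mem_setOf_eq, not_le] at hx
      exact hx.le
    exact absurd ht (not_lt.2 (essSup_le_of_ae_le t hae))
  rcases eq_or_ne t 0 with rfl | ht0
  · exact zero_le
  -- Chebyshev at the exponent `p k`
  have hpk : ∀ k, (ENNReal.ofReal (p k)).toReal = p k := fun k => ENNReal.toReal_ofReal (hp k).le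
  have hcheb : ∀ k, t * μ S ^ (1 / p k) ≤ L k := by
    intro k
    have h0 : ENNReal.ofReal (p k) ≠ 0 := by simp [(hp k)]
    have h1 := mul_meas_ge_le_pow_eLpNorm' μ h0 ENNReal.ofReal_ne_top hf t
    rw [hpk k] at h1
    have hpinv : 0 ≤ 1 / p k := by have := hp k; positivity
    have h2 := ENNReal.rpow_le_rpow h1 hpinv
    rw [ENNReal.mul_rpow_of_nonneg _ _ hpinv, ← ENNReal.rpow_mul, ← ENNReal.rpow_mul,
      mul_one_div_cancel (hp k).ne', ENNReal.rpow_one, ENNReal.rpow_one] at h2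
    exact h2.trans (hL k)
  -- pass to the limit
  rcases eq_or_ne (μ S) ∞ with hSt | hSt
  · -- every `L k` is infinite
    have hLk : ∀ k, L k = ∞ := by
      intro k
      have h := hcheb k
      rw [hSt, ENNReal.top_rpow_of_pos (by have := hp k; positivity), ENNReal.mul_top ht0,
        top_le_iff] at h
      exact h
    have hLfun : L = fun _ => ∞ := funext hLk
    rw [hLfun] at hLim
    have : Lim = ∞ := tendsto_nhds_unique hLim tendsto_const_nhds
    rw [this]
    exact le_top
  · -- `μ S ^ (1 / p k) → 1`
    obtain ⟨m, hm⟩ : ∃ m : ℝ≥0, μ S = m := ⟨(μ S).toNNReal, (ENNReal.coe_toNNReal hSt).symm⟩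
    have hm0 : m ≠ 0 := by rintro rfl; exact hS0 (by simp [hm])
    have hinv : Tendsto (fun k => 1 / p k) atTop (𝓝 0) := by
      simpa only [one_div, Function.comp_def] using tendsto_inv_atTop_zero.comp hptop
    have hreal : Tendsto (fun k => (m : ℝ) ^ (1 / p k)) atTop (𝓝 1) := by
      have hc : ContinuousAt (fun y : ℝ => (m : ℝ) ^ y) 0 :=
        Real.continuousAt_const_rpow (by exact_mod_cast hm0)
      have := hc.tendsto.comp hinv
      simpa [Function.comp_def, Real.rpow_zero] using this
    have hnn : Tendsto (fun k => m ^ (1 / p k)) atTop (𝓝 (1 : ℝ≥0)) := by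
      rw [← NNReal.tendsto_coe]
      simpa [NNReal.coe_rpow] using hreal
    have henn : Tendsto (fun k => μ S ^ (1 / p k)) atTop (𝓝 (1 : ℝ≥0∞)) := by
      have h := ENNReal.tendsto_coe.2 hnn
      simp only [ENNReal.coe_one] at h
      refine h.congr fun k => ?_
      rw [hm, ENNReal.coe_rpow_of_ne_zero hm0]
    have hlhs : Tendsto (fun k => t * μ S ^ (1 / p k)) atTop (𝓝 (t * 1)) :=
      ENNReal.Tendsto.const_mul henn (Or.inl one_ne_zero)
    rw [mul_one] at hlhs
    exact le_of_tendsto_of_tendsto hlhs hLim (Eventually.of_forall hcheb)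

/-- `∑ⱼ 1/(p₀ χ^j) = χ/(p₀(χ − 1))` for `χ > 1` (geometric series). [folklore] -/
theorem hasSum_one_div_mul_pow {p₀ χ : ℝ} (hp₀ : 0 < p₀) (hχ : 1 < χ) :
    HasSum (fun j : ℕ => 1 / (p₀ * χ ^ j)) (χ / (p₀ * (χ - 1))) := by
  have hχ0 : 0 < χ := zero_lt_one.trans hχ
  have hr0 : 0 ≤ χ⁻¹ := inv_nonneg.2 hχ0.le
  have hr1 : χ⁻¹ < 1 := inv_lt_one_of_one_lt₀ hχ
  have h := (hasSum_geometric_of_lt_one hr0 hr1).mul_left p₀⁻¹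
  have hval : p₀⁻¹ * (1 - χ⁻¹)⁻¹ = χ / (p₀ * (χ - 1)) := by
    field_simp
  rw [hval] at h
  refine h.congr_fun fun j => ?_
  rw [inv_pow]
  field_simp

/-- `∑ⱼ j/(p₀ χ^j) = χ/(p₀(χ − 1)²)` for `χ > 1` (`∑ n rⁿ = r/(1 − r)²`). [folklore] -/
theorem hasSum_natCast_div_mul_pow {p₀ χ : ℝ} (hp₀ : 0 < p₀) (hχ : 1 < χ) :
    HasSum (fun j : ℕ => (j : ℝ) / (p₀ * χ ^ j)) (χ / (p₀ * (χ - 1) ^ 2)) := by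
  have hχ0 : 0 < χ := zero_lt_one.trans hχ
  have hr1 : ‖(χ⁻¹ : ℝ)‖ < 1 := by
    rw [Real.norm_eq_abs, abs_of_nonneg (inv_nonneg.2 hχ0.le)]
    exact inv_lt_one_of_one_lt₀ hχ
  have h := (hasSum_coe_mul_geometric_of_norm_lt_one hr1).mul_left p₀⁻¹
  have hval : p₀⁻¹ * (χ⁻¹ / (1 - χ⁻¹) ^ 2) = χ / (p₀ * (χ - 1) ^ 2) := by
    have hχ1 : χ - 1 ≠ 0 := by linarith
    field_simp
  rw [hval] at h
  refine h.congr_fun fun j => ?_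
  rw [inv_pow]
  field_simp

/-- **Moser's iteration.** Let `A₀, A₁, …` be sets (in applications a decreasing sequence of
cylinders), `p_k = p₀ χ^k` with `p₀ > 0`, `χ > 1`, and `C₀, b > 0`. If `f` satisfies the
chain of reverse Hölder inequalities
`‖f‖_{L^{p_{k+1}}(A_{k+1})} ≤ (C₀ b^k)^{1/p_k} ‖f‖_{L^{p_k}(A_k)}` for all `k`, then
`‖f‖_{L^∞(⋂ₖ A_k)} ≤ C₀^{χ/(p₀(χ−1))} b^{χ/(p₀(χ−1)²)} ‖f‖_{L^{p₀}(A₀)}` — the exponents being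
`∑ₖ 1/p_k` and `∑ₖ k/p_k` (Gilbarg–Trudinger, proof of Thm. 8.15; Lieberman §VI.5; the step
(2.5) ⇒ (2.6) of Lei–Zhang 2011). [cite: Lieberman1996, §VI.5 (Moser iteration); LeiZhang2011, (2.5)–(2.6) (arXiv p. 8)] -/
theorem eLpNorm_top_le_of_moser_chain {f : α → E} (hf : AEStronglyMeasurable f μ)
    {A : ℕ → Set α} {p₀ χ : ℝ} (hp₀ : 0 < p₀) (hχ : 1 < χ)
    {C₀ b : ℝ≥0} (hC₀ : C₀ ≠ 0) (hb : b ≠ 0)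
    (H : ∀ k : ℕ, eLpNorm f (ENNReal.ofReal (p₀ * χ ^ (k + 1))) (μ.restrict (A (k + 1))) ≤
      ((C₀ : ℝ≥0∞) * (b : ℝ≥0∞) ^ k) ^ (1 / (p₀ * χ ^ k)) *
        eLpNorm f (ENNReal.ofReal (p₀ * χ ^ k)) (μ.restrict (A k))) :
    eLpNorm f ∞ (μ.restrict (⋂ k, A k)) ≤
      (C₀ : ℝ≥0∞) ^ (χ / (p₀ * (χ - 1))) * (b : ℝ≥0∞) ^ (χ / (p₀ * (χ - 1) ^ 2)) *
        eLpNorm f (ENNReal.ofReal p₀) (μ.restrict (A 0)) := by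
  have hχ0 : 0 < χ := zero_lt_one.trans hχ
  -- notation
  set N : ℕ → ℝ≥0∞ := fun k => eLpNorm f (ENNReal.ofReal (p₀ * χ ^ k)) (μ.restrict (A k)) with hN
  set s : ℕ → ℝ := fun k => ∑ j ∈ Finset.range k, 1 / (p₀ * χ ^ j) with hs
  set r : ℕ → ℝ := fun k => ∑ j ∈ Finset.range k, (j : ℝ) / (p₀ * χ ^ j) with hr
  have hC : (C₀ : ℝ≥0∞) ≠ 0 := by exact_mod_cast hC₀
  have hB : (b : ℝ≥0∞) ≠ 0 := by exact_mod_cast hb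
  -- the finite chain: `N k ≤ C₀^{s k} b^{r k} N 0`
  have hchain : ∀ k, N k ≤ (C₀ : ℝ≥0∞) ^ s k * (b : ℝ≥0∞) ^ r k * N 0 := by
    intro k
    induction k with
    | zero => simp [hs, hr]
    | succ k ih =>
      have hpk : 0 < p₀ * χ ^ k := by positivity
      have hfac : ((C₀ : ℝ≥0∞) * (b : ℝ≥0∞) ^ k) ^ (1 / (p₀ * χ ^ k)) =
          (C₀ : ℝ≥0∞) ^ (1 / (p₀ * χ ^ k)) * (b : ℝ≥0∞) ^ ((k : ℝ) / (p₀ * χ ^ k)) := by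
        rw [ENNReal.mul_rpow_of_nonneg _ _ (by positivity), ← ENNReal.rpow_natCast,
          ← ENNReal.rpow_mul]
        congr 2
        ring
      have hs' : s (k + 1) = s k + 1 / (p₀ * χ ^ k) := by
        simp only [hs, Finset.sum_range_succ]
      have hr' : r (k + 1) = r k + (k : ℝ) / (p₀ * χ ^ k) := by
        simp only [hr, Finset.sum_range_succ]
      calc N (k + 1) ≤ ((C₀ : ℝ≥0∞) * (b : ℝ≥0∞) ^ k) ^ (1 / (p₀ * χ ^ k)) * N k := H k
        _ ≤ ((C₀ : ℝ≥0∞) * (b : ℝ≥0∞) ^ k) ^ (1 / (p₀ * χ ^ k)) *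
            ((C₀ : ℝ≥0∞) ^ s k * (b : ℝ≥0∞) ^ r k * N 0) := by gcongr
        _ = (C₀ : ℝ≥0∞) ^ s (k + 1) * (b : ℝ≥0∞) ^ r (k + 1) * N 0 := by
            rw [hfac, hs', hr', ENNReal.rpow_add _ _ hC ENNReal.coe_ne_top,
              ENNReal.rpow_add _ _ hB ENNReal.coe_ne_top]
            ring
  -- restrict to `⋂ A k`
  set A' : Set α := ⋂ k, A k with hA'
  have hsub : ∀ k, A' ⊆ A k := fun k => iInter_subset _ k
  have hL : ∀ k, eLpNorm f (ENNReal.ofReal (p₀ * χ ^ k)) (μ.restrict A') ≤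
      (C₀ : ℝ≥0∞) ^ s k * (b : ℝ≥0∞) ^ r k * N 0 := fun k =>
    (eLpNorm_mono_measure f (Measure.restrict_mono (hsub k) le_rfl)).trans (hchain k)
  -- the limits of the exponents
  have hs_lim : Tendsto s atTop (𝓝 (χ / (p₀ * (χ - 1)))) :=
    (hasSum_one_div_mul_pow hp₀ hχ).tendsto_sum_nat
  have hr_lim : Tendsto r atTop (𝓝 (χ / (p₀ * (χ - 1) ^ 2))) :=
    (hasSum_natCast_div_mul_pow hp₀ hχ).tendsto_sum_nat
  -- `C₀ ^ s k → C₀ ^ S₁`, `b ^ r k → b ^ S₂` in `ℝ≥0∞`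
  have hpow : ∀ {c : ℝ≥0} (_ : c ≠ 0) {e : ℕ → ℝ} {e₀ : ℝ} (_ : Tendsto e atTop (𝓝 e₀)),
      Tendsto (fun k => (c : ℝ≥0∞) ^ e k) atTop (𝓝 ((c : ℝ≥0∞) ^ e₀)) := by
    intro c hc e e₀ he
    have hreal : Tendsto (fun k => (c : ℝ) ^ e k) atTop (𝓝 ((c : ℝ) ^ e₀)) :=
      ((Real.continuousAt_const_rpow (by exact_mod_cast hc)).tendsto).comp he
    have hnn : Tendsto (fun k => c ^ e k) atTop (𝓝 (c ^ e₀)) := by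
      rw [← NNReal.tendsto_coe]
      simpa [NNReal.coe_rpow] using hreal
    have h := ENNReal.tendsto_coe.2 hnn
    simp only [ENNReal.coe_rpow_of_ne_zero hc] at h
    exact h
  have hC_lim := hpow hC₀ hs_lim
  have hb_lim := hpow hb hr_lim
  have hCb_lim : Tendsto (fun k => (C₀ : ℝ≥0∞) ^ s k * (b : ℝ≥0∞) ^ r k) atTop
      (𝓝 ((C₀ : ℝ≥0∞) ^ (χ / (p₀ * (χ - 1))) * (b : ℝ≥0∞) ^ (χ / (p₀ * (χ - 1) ^ 2)))) :=
    ENNReal.Tendsto.mul hC_lim (Or.inr (ENNReal.rpow_ne_top_of_nonneg' (by positivity)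
      ENNReal.coe_ne_top)) hb_lim (Or.inr (ENNReal.rpow_ne_top_of_nonneg' (by positivity)
      ENNReal.coe_ne_top))
  have hLim : Tendsto (fun k => (C₀ : ℝ≥0∞) ^ s k * (b : ℝ≥0∞) ^ r k * N 0) atTop
      (𝓝 ((C₀ : ℝ≥0∞) ^ (χ / (p₀ * (χ - 1))) * (b : ℝ≥0∞) ^ (χ / (p₀ * (χ - 1) ^ 2)) * N 0)) := by
    refine ENNReal.Tendsto.mul_const hCb_lim (Or.inl ?_)
    exact mul_ne_zero ((ENNReal.rpow_pos (pos_iff_ne_zero.2 hC) ENNReal.coe_ne_top).ne')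
      ((ENNReal.rpow_pos (pos_iff_ne_zero.2 hB) ENNReal.coe_ne_top).ne')
  -- conclude by the `L^∞ ≤ lim L^{p_k}` lemma
  have hp : ∀ k, 0 < p₀ * χ ^ k := fun k => by positivity
  have hptop : Tendsto (fun k => p₀ * χ ^ k) atTop atTop :=
    (tendsto_pow_atTop_atTop_of_one_lt hχ).const_mul_atTop hp₀
  have h := eLpNorm_top_le_of_eLpNorm_le_of_tendsto (μ := μ.restrict A') hf.restrict hp hptop
    hL hLim
  simpa [hN] using h

end Literature.Analysis.FunctionSpaces
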